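import Literature.Analysis.FluidPDE.LocalLeraySolutions
import Literature.Analysis.FluidPDE.DistributionalToWeak
import Literature.Analysis.FluidPDE.SuitableWeakPressure
import Literature.Analysis.FluidPDE.WeakSolutionProofs
import Literature.Analysis.FunctionSpaces.DuBoisReymondAE
import HarnessLib

/-!
# Local Leray solutions near the initial time, I: the pairing with a test field

Analysis/FluidPDE proofs file (no new definitions), first of two files serving the proof of the
named fact `bradshawTsai2019_limitDatum` (`ForwardDSSCylinderLimitParts.lean`: continuity of
the limit of local Leray solutions at `t = 0` in local `L²`, Bradshaw–Tsai, Analysis & PDE 12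
(2019) = arXiv:1801.08060, §4.3: "For compact subsets `K` of `B₁`, we automatically have
`lim_{t→0⁺} ‖v − v₀‖_{L²(K)} = 0`"; the printed argument is Lemarié-Rieusset's Prop. 14.1:
weak continuity at `t = 0` from the equations plus `limsup_{t→0⁺} ∫|v(t)|²φ ≤ ∫|v₀|²φ` from
the local energy inequality). This file supplies the **weak continuity** half, for one solution:

* `weakIdentity_datum_pressure` — the weak identity *with datum and with the pressure kept*:
  for a distributional (pressure-explicit) solution `(u, p)` on the open slab `(0,T) × E` with
  `u ∈ L²`, `p ∈ L¹` on the finite cylinders up to `t = 0` and attaining the measurable datum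
  `u₀` in `L²_loc`, and every test field `ψ` on `(-∞, T) × E` (not necessarily divergence
  free), `∫₀ᵀ∫ (⟪u, ∂ₜψ⟫ + ⟪u, (u·∇)ψ⟫ + ν⟪u, Δψ⟫ + p div ψ + ⟪f, ψ⟫) + ∫⟪u₀, ψ(0)⟫ = 0`
  (the companion of the accepted `weakIdentity_datum_of_distributional`, same cut-off argument:
  Robinson–Rodrigo–Sadowski 2016, §3.1, (3.1));
* `ae_pairing_eq_datum_add_setIntegral` — testing with `η(t) φ(x)` turns this into the
  hypothesis of the du Bois-Reymond lemma with initial datum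
  (`FunctionSpaces.ae_eq_add_setIntegral_of_forall_test`, Brezis 2011, Lemma 8.1), whence for
  a.e. `t ∈ (0,T)`: `⟨u(t), φ⟩ = ⟨u₀, φ⟩ + ∫₀ᵗ∫ (⟪u, (u·∇)φ⟫ + ν⟪u, Δφ⟫ + p div φ + ⟪f, φ⟫)`
  (Lemarié-Rieusset 2016, Prop. 14.1, first step; Robinson–Rodrigo–Sadowski 2016, Lemma 3.7);
* `IsLocalLeraySolution.ae_pairing_eq_datum_add` — the same for a local Leray solution
  (Kang–Miura–Tsai Def. 3.2) and a.e. `t ∈ (0, T)`, any `T > 0` (its pressure is in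
  `L^{3/2} ⊂ L¹` of the finite cylinders, `IsLocalLeraySolution.integrableOn_pressure_cylinder`).

## References

* P. G. Lemarié-Rieusset, *The Navier–Stokes Problem in the 21st Century*, CRC Press (2016),
  Prop. 14.1 [LemarieRieusset2016].
* J. C. Robinson, J. L. Rodrigo, W. Sadowski, *The Three-Dimensional Navier–Stokes Equations*,
  CUP (2016), §3.1 (3.1), Lemma 3.7 [RobinsonRodrigoSadowski2016].
* H. Brezis, *Functional Analysis, Sobolev Spaces and PDE* (2011), Lemma 8.1 [Brezis2011].
* Z. Bradshaw, T.-P. Tsai, Analysis & PDE 12 (2019) = arXiv:1801.08060, §4.3 [BradshawTsai2019].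
-/

noncomputable section

open MeasureTheory TopologicalSpace Set Function Filter Topology Metric
open scoped ENNReal NNReal RealInnerProductSpace Laplacian

namespace Literature.Analysis.FluidPDE

namespace BradshawTsai2019

variable {E : Type*} [NormedAddCommGroup E] [InnerProductSpace ℝ E] [FiniteDimensional ℝ E]
  [MeasurableSpace E] [BorelSpace E]

variable {T ν : ℝ} {f u : ℝ → E → E} {u₀ : E → E} {p : ℝ → E → ℝ}

/-- **Products on the slab are integrable** (scalar companion of `integrable_slab_inner`): if
`F` is integrable on `(0,T) × K` and `g` is continuous and vanishes for `x ∉ K`, then `F g` is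
integrable for `dt|_(0,T) ⊗ dx`. [folklore] -/
theorem integrable_slab_mul {F g : ℝ × E → ℝ} {K : Set E} (hK : IsCompact K)
    (hF : IntegrableOn F (Ioo 0 T ×ˢ K) volume) (hg : Continuous g)
    (hgK : ∀ t x, x ∉ K → g (t, x) = 0) :
    Integrable (fun z => F z * g z)
      (((volume : Measure ℝ).restrict (Ioo 0 T)).prod (volume : Measure E)) := by
  obtain ⟨C, hC0, hC⟩ := exists_norm_le_of_continuous_of_eq_zero hK hg hgK T
  rw [← volume_restrict_slab_eq]
  have h1 : IntegrableOn (fun z => F z * g z) (Ioo 0 T ×ˢ K) volume := by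
    refine Integrable.mono' (hF.norm.mul_const C) (hF.1.mul hg.aestronglyMeasurable) ?_
    filter_upwards [ae_restrict_mem (measurableSet_Ioo.prod hK.measurableSet)] with z hz
    rw [norm_mul]
    exact mul_le_mul_of_nonneg_left (hC z ⟨hz.1, mem_univ _⟩) (norm_nonneg _)
  refine h1.of_forall_sdiff_eq_zero (measurableSet_Ioo.prod MeasurableSet.univ) fun z hz => ?_
  have hz2 : z.2 ∉ K := fun h => hz.2 ⟨hz.1.1, h⟩
  obtain ⟨t, x⟩ := z
  rw [hgK t x hz2, mul_zero]

/-- **The weak identity with datum, pressure kept** (companion of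
`weakIdentity_datum_of_distributional` without the divergence-free restriction on the test
field). Let `(u, p)` satisfy the pressure-explicit momentum identity against all test fields on
the open slab `(0,T) × E`, with `u, ‖u‖², p` and `f` integrable on the finite cylinders
`(0,T) × K`, a.e. slice of `u` measurable and locally `L²`, `u₀` measurable, and `u(t) → u₀` in
`L²_loc` as `t → 0⁺`. Then for every test field `ψ` on `(-∞, T) × E`,
`∫₀ᵀ ∫ (⟪u, ∂ₜψ⟫ + ⟪u, (u·∇)ψ⟫ + ν ⟪u, Δψ⟫ + p div ψ + ⟪f, ψ⟫) + ∫ ⟪u₀, ψ(0)⟫ = 0`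
(test with `η_δ(t) ψ`, `η_δ` a monotone cut-off vanishing near `t = 0`, and let `δ → 0`:
Robinson–Rodrigo–Sadowski 2016, §3.1, the time integration by parts producing `⟨u(0), φ(0)⟩`;
Caffarelli–Kohn–Nirenberg 1982, (2.2)). [cite: RobinsonRodrigoSadowski2016, §3.1 p. 58 (3.1)] -/
theorem weakIdentity_datum_pressure (hT : 0 < T)
    (hUK : ∀ K : Set E, IsCompact K → IntegrableOn (uncurry u) (Ioo 0 T ×ˢ K) volume ∧
      IntegrableOn (fun z => ‖uncurry u z‖ ^ 2) (Ioo 0 T ×ˢ K) volume)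
    (hpK : ∀ K : Set E, IsCompact K → IntegrableOn (uncurry p) (Ioo 0 T ×ˢ K) volume)
    (hmom : ∀ ψ : ℝ → E → E, IsSpaceTimeTestOn (slab E (Ioo 0 T) isOpen_Ioo) ψ →
      ∫ z in Ioo 0 T ×ˢ (univ : Set E), (⟪u z.1 z.2, timeDeriv ψ z.1 z.2⟫ +
        ⟪u z.1 z.2, convect (u z.1) (ψ z.1) z.2⟫ + ν * ⟪u z.1 z.2, Δ (ψ z.1) z.2⟫ +
        p z.1 z.2 * VectorCalculus.divergence (ψ z.1) z.2 + ⟪f z.1 z.2, ψ z.1 z.2⟫) = 0)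
    (hf : ∀ K : Set E, IsCompact K → IntegrableOn (uncurry f) (Ioo 0 T ×ˢ K) volume)
    (hgood : ∀ᵐ t ∂((volume : Measure ℝ).restrict (Ioo 0 T)),
      AEStronglyMeasurable (u t) (volume : Measure E) ∧
        ∀ n : ℕ, ∫⁻ x in closedBall (0 : E) n, ‖u t x‖ₑ ^ 2 < ∞)
    (hm₀ : AEStronglyMeasurable u₀ (volume : Measure E))
    (h₀ : ∀ K : Set E, IsCompact K →
      Tendsto (fun t => ∫⁻ x in K, ‖u t x - u₀ x‖ₑ ^ 2) (𝓝[>] 0) (𝓝 0))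
    {ψ : ℝ → E → E} (hψ : IsSpaceTimeTestOn (slab E (Iio T) isOpen_Iio) ψ) :
    (∫ t in Ioo 0 T, ∫ x, (⟪u t x, timeDeriv ψ t x⟫ + ⟪u t x, convect (u t) (ψ t) x⟫ +
        ν * ⟪u t x, Δ (ψ t) x⟫ + p t x * VectorCalculus.divergence (ψ t) x + ⟪f t x, ψ t x⟫)) +
      ∫ x, ⟪u₀ x, ψ 0 x⟫ = 0 := by
  -- the compact `x`-shadow of `ψ`, enlarged to a closed ball `K`
  obtain ⟨K₀, hK₀, hK₀t⟩ := hψ.exists_compact_slice_subset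
  obtain ⟨r, hr⟩ := hK₀.isBounded.subset_closedBall (0 : E)
  set n : ℕ := ⌈r⌉₊ with hn
  set K : Set E := closedBall (0 : E) n with hK_def
  have hK : IsCompact K := isCompact_closedBall _ _
  have hKt : ∀ t, tsupport (ψ t) ⊆ K := fun t =>
    (hK₀t t).trans (hr.trans (closedBall_subset_closedBall (Nat.le_ceil r)))
  have hψ0 : ∀ t x, x ∉ K → ψ t x = 0 := fun t x hx =>
    image_eq_zero_of_notMem_tsupport fun h' => hx (hKt t h')
  -- regularity of the test-field ingredients as functions on `ℝ × E`
  have cψ : Continuous (uncurry ψ) := hψ.contDiff.continuous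
  have cψ' : Continuous (uncurry (timeDeriv ψ)) := hψ.continuous_timeDeriv
  have cD : Continuous fun z : ℝ × E => fderiv ℝ (ψ z.1) z.2 := by
    have h := ((hψ.isSmoothSpaceTimeOn univ).fderiv_slice uniqueDiffOn_univ).continuousOn
    rw [univ_prod_univ, continuousOn_univ] at h
    exact h
  have cL : Continuous fun z : ℝ × E => Δ (ψ z.1) z.2 := by
    have h := ((hψ.isSmoothSpaceTimeOn univ).laplacian uniqueDiffOn_univ).continuousOn
    rw [univ_prod_univ, continuousOn_univ] at h
    exact h
  obtain ⟨cdiv, -⟩ := hψ.continuous_divergence_field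
  have hψd : ∀ t, Differentiable ℝ (ψ t) := fun t =>
    (hψ.contDiff_slice t).differentiable (by simp)
  have hψ2 : ∀ t, ContDiff ℝ 2 (ψ t) := fun t => contDiff_infty.1 (hψ.contDiff_slice t) 2
  have hD0 : ∀ t x, x ∉ K → fderiv ℝ (ψ t) x = 0 := fun t x hx =>
    fderiv_of_notMem_tsupport ℝ fun h => hx (hKt t h)
  have hL0 : ∀ t x, x ∉ K → Δ (ψ t) x = 0 := fun t x hx =>
    laplacian_eq_zero_of_notMem_tsupport fun h => hx (hKt t h)
  have hψ'0 : ∀ t x, x ∉ K → timeDeriv ψ t x = 0 := fun t x hx =>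
    timeDeriv_eq_zero_of_forall (fun s => hψ0 s x hx) t
  have hdiv0 : ∀ t x, x ∉ K → VectorCalculus.divergence (ψ t) x = 0 := fun t x hx => by
    simp [VectorCalculus.divergence, hD0 t x hx]
  -- integrability on the slab
  obtain ⟨hUK1, hUK2⟩ := hUK K hK
  have iA : Integrable (fun z : ℝ × E => ⟪u z.1 z.2, timeDeriv ψ z.1 z.2⟫)
      (((volume : Measure ℝ).restrict (Ioo 0 T)).prod (volume : Measure E)) :=
    integrable_slab_inner hK hUK1 cψ' hψ'0
  have iB : Integrable (fun z : ℝ × E => ⟪u z.1 z.2, convect (u z.1) (ψ z.1) z.2⟫)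
      (((volume : Measure ℝ).restrict (Ioo 0 T)).prod (volume : Measure E)) :=
    integrable_slab_inner_clm_apply hK hUK1 hUK2 cD hD0
  have iC : Integrable (fun z : ℝ × E => ⟪u z.1 z.2, Δ (ψ z.1) z.2⟫)
      (((volume : Measure ℝ).restrict (Ioo 0 T)).prod (volume : Measure E)) :=
    integrable_slab_inner hK hUK1 cL hL0
  have iP : Integrable (fun z : ℝ × E => p z.1 z.2 * VectorCalculus.divergence (ψ z.1) z.2)
      (((volume : Measure ℝ).restrict (Ioo 0 T)).prod (volume : Measure E)) :=
    integrable_slab_mul hK (hpK K hK) cdiv hdiv0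
  have iF : Integrable (fun z : ℝ × E => ⟪f z.1 z.2, ψ z.1 z.2⟫)
      (((volume : Measure ℝ).restrict (Ioo 0 T)).prod (volume : Measure E)) :=
    integrable_slab_inner hK (hf K hK) cψ hψ0
  have iU : Integrable (fun z : ℝ × E => ⟪u z.1 z.2, ψ z.1 z.2⟫)
      (((volume : Measure ℝ).restrict (Ioo 0 T)).prod (volume : Measure E)) :=
    integrable_slab_inner hK hUK1 cψ hψ0
  set Φ : ℝ × E → ℝ := fun z => ⟪u z.1 z.2, timeDeriv ψ z.1 z.2⟫ +
    ⟪u z.1 z.2, convect (u z.1) (ψ z.1) z.2⟫ + ν * ⟪u z.1 z.2, Δ (ψ z.1) z.2⟫ +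
    p z.1 z.2 * VectorCalculus.divergence (ψ z.1) z.2 + ⟪f z.1 z.2, ψ z.1 z.2⟫ with hΦ
  have iΦ : Integrable Φ (((volume : Measure ℝ).restrict (Ioo 0 T)).prod (volume : Measure E)) :=
    (((iA.add iB).add (iC.const_mul ν)).add iP).add iF
  -- the pairing `U(t) = ⟨u(t), ψ(t)⟩` and its a.e. limit at `0⁺`
  set U : ℝ → ℝ := fun t => ∫ x, ⟪u t x, ψ t x⟫ with hU_def
  set L : ℝ := ∫ x, ⟪u₀ x, ψ 0 x⟫ with hL_def
  have hUint : IntegrableOn U (Ioo 0 T) := iU.integral_prod_left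
  have hgoodK : ∀ᵐ t ∂((volume : Measure ℝ).restrict (Ioo 0 T)),
      AEStronglyMeasurable (u t) (volume : Measure E) ∧ ∫⁻ x in K, ‖u t x‖ₑ ^ 2 < ∞ := by
    filter_upwards [hgood] with t ht
    exact ⟨ht.1, ht.2 n⟩
  have hu₀ : ∫⁻ x in K, ‖u₀ x‖ₑ ^ 2 < ∞ := lintegral_datum_sq_lt_top hT hgoodK hm₀ (h₀ K hK)
  have hlim : ∀ ε > 0, ∃ τ > 0, ∀ᵐ t ∂((volume : Measure ℝ).restrict (Ioo 0 τ)), |U t - L| ≤ ε :=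
    fun ε hε => exists_ae_abs_pairing_sub_datum_le hT hK hgoodK hm₀ hu₀ (h₀ K hK) cψ
      hψ.hasCompactSupport hψ0 hε
  -- the cut-offs `η k` with derivatives `ρ k`, at scale `δ k = T / (6 (k + 1))`
  set δ : ℕ → ℝ := fun k => T / (6 * ((k : ℝ) + 1)) with hδ
  have hδ0 : ∀ k, 0 < δ k := fun k => by positivity
  have hδT : ∀ k, 3 * δ k ≤ T := fun k => by
    have hk : (0 : ℝ) ≤ k := Nat.cast_nonneg k
    have h1 : δ k ≤ T / 6 := by
      show T / (6 * ((k : ℝ) + 1)) ≤ T / 6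
      exact div_le_div_of_nonneg_left hT.le (by norm_num) (by nlinarith)
    linarith
  have hδlim : Tendsto δ atTop (𝓝 0) := by
    have h1 : Tendsto (fun k : ℕ => (k : ℝ) + 1) atTop atTop :=
      tendsto_atTop_add_const_right _ 1 tendsto_natCast_atTop_atTop
    have h2 : Tendsto (fun k : ℕ => 6 * ((k : ℝ) + 1)) atTop atTop :=
      h1.const_mul_atTop (by norm_num)
    exact tendsto_const_nhds.div_atTop h2
  choose η ρ hηs hρc hηρ hη0 hη1 hη01 hρ0 hρsupp hρ1 using fun k => exists_smooth_time_cutoff (hδ0 k)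
  have hηabs : ∀ k s, |η k s| ≤ 1 := fun k s => by
    rw [abs_le]
    exact ⟨by linarith [(hη01 k s).1], (hη01 k s).2⟩
  have hρC : ∀ k, ∃ C, 0 ≤ C ∧ ∀ s, |ρ k s| ≤ C := fun k =>
    exists_abs_le_of_eq_zero_off_Ioo (hρc k) (hρsupp k)
  -- Step 1: the tested identity for each `k`
  have hAB : ∀ k, (∫ z, η k z.1 * Φ z ∂(((volume : Measure ℝ).restrict (Ioo 0 T)).prod
      (volume : Measure E))) + ∫ t in Ioo 0 T, ρ k t * U t = 0 := by
    intro k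
    obtain ⟨C, -, hC⟩ := hρC k
    have hψk : IsSpaceTimeTestOn (slab E (Ioo 0 T) isOpen_Ioo) (fun s x => η k s • ψ s x) :=
      hψ.cutoff (hδ0 k) (hηs k) (hη0 k)
    have key := hmom _ hψk
    have key' : ∫ z in Ioo 0 T ×ˢ (univ : Set E),
        (ρ k z.1 * ⟪u z.1 z.2, ψ z.1 z.2⟫ + η k z.1 * Φ z) = 0 := by
      refine Eq.trans (setIntegral_congr_fun (measurableSet_Ioo.prod MeasurableSet.univ)
        fun z _ => ?_) key
      rw [hΦ]
      dsimp only
      rw [timeDeriv_cutoff (hηρ k) hψ.hasDerivAt_time, convect_fun_const_smul _ (hψd z.1 z.2),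
        laplacian_fun_const_smul (hψ2 z.1), divergence_fun_const_smul (hψd z.1 z.2)]
      simp only [inner_add_right, real_inner_smul_right]
      ring
    have iρU : Integrable (fun z : ℝ × E => ρ k z.1 * ⟪u z.1 z.2, ψ z.1 z.2⟫)
        (((volume : Measure ℝ).restrict (Ioo 0 T)).prod (volume : Measure E)) :=
      integrable_time_mul iU (hρc k) hC
    have iηΦ : Integrable (fun z : ℝ × E => η k z.1 * Φ z)
        (((volume : Measure ℝ).restrict (Ioo 0 T)).prod (volume : Measure E)) :=
      integrable_time_mul iΦ (hηs k).continuous (hηabs k)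
    rw [volume_restrict_slab_eq, integral_add iρU iηΦ, integral_prod _ iρU] at key'
    simp only [integral_const_mul] at key'
    rw [add_comm]
    exact key'
  -- Step 2: the limits `k → ∞`
  have hA : Tendsto (fun k => ∫ z, η k z.1 * Φ z ∂(((volume : Measure ℝ).restrict (Ioo 0 T)).prod
      (volume : Measure E))) atTop
      (𝓝 (∫ z, Φ z ∂(((volume : Measure ℝ).restrict (Ioo 0 T)).prod (volume : Measure E)))) := by
    refine tendsto_integral_of_dominated_convergence (fun z => ‖Φ z‖)
      (fun k => (integrable_time_mul iΦ (hηs k).continuous (hηabs k)).aestronglyMeasurable)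
      iΦ.norm (fun k => Eventually.of_forall fun z => ?_) ?_
    · rw [norm_mul, Real.norm_eq_abs]
      exact mul_le_of_le_one_left (norm_nonneg _) (hηabs k z.1)
    · have hmem : ∀ᵐ z ∂(((volume : Measure ℝ).restrict (Ioo 0 T)).prod (volume : Measure E)),
          z ∈ Ioo 0 T ×ˢ (univ : Set E) := by
        rw [← volume_restrict_slab_eq]
        exact ae_restrict_mem (measurableSet_Ioo.prod MeasurableSet.univ)
      filter_upwards [hmem] with z hz
      have hz1 : 0 < z.1 := hz.1.1
      have h3 : Tendsto (fun k => 3 * δ k) atTop (𝓝 0) := by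
        simpa using hδlim.const_mul 3
      have hev : ∀ᶠ k in atTop, 3 * δ k < z.1 := (tendsto_order.1 h3).2 _ hz1
      refine (tendsto_const_nhds (x := Φ z)).congr' ?_
      filter_upwards [hev] with k hk
      rw [hη1 k z.1 hk.le, one_mul]
  have hB : Tendsto (fun k => ∫ t in Ioo 0 T, ρ k t * U t) atTop (𝓝 L) :=
    tendsto_setIntegral_mul_of_ae_tendsto hUint hlim hδlim hδ0 hδT hρc hρ0 hρsupp hρ1
  have hsum : (∫ z, Φ z ∂(((volume : Measure ℝ).restrict (Ioo 0 T)).prod (volume : Measure E))) +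
      L = 0 :=
    tendsto_nhds_unique (hA.add hB) (by simpa only [hAB] using tendsto_const_nhds)
  rw [integral_prod _ iΦ] at hsum
  exact hsum

/-- **The pairing with a fixed test field, from the initial time, at a.e. slice.** Under the
hypotheses of `weakIdentity_datum_pressure`, for every test field `φ ∈ C_c^∞(E; E)` and a.e.
`t ∈ (0, T)`,
`⟨u(t), φ⟩ = ⟨u₀, φ⟩ + ∫₀ᵗ ∫ (⟪u, (u·∇)φ⟫ + ν ⟪u, Δφ⟫ + p div φ + ⟪f, φ⟫)`:
the weak identity with datum tested with `η(t) φ(x)` is the hypothesis of the du Bois-Reymond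
lemma with initial datum (`FunctionSpaces.ae_eq_add_setIntegral_of_forall_test`, Brezis 2011,
Lemma 8.1) for `U(t) = ⟨u(t), φ⟩`. This is the weak continuity in time of weak solutions
(Robinson–Rodrigo–Sadowski 2016, Lemma 3.7 / (3.1); Lemarié-Rieusset 2016, Prop. 14.1, first
step). [cite: RobinsonRodrigoSadowski2016, §3.1 p. 58 (3.1)] -/
theorem ae_pairing_eq_datum_add_setIntegral (hT : 0 < T)
    (hUK : ∀ K : Set E, IsCompact K → IntegrableOn (uncurry u) (Ioo 0 T ×ˢ K) volume ∧
      IntegrableOn (fun z => ‖uncurry u z‖ ^ 2) (Ioo 0 T ×ˢ K) volume)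
    (hpK : ∀ K : Set E, IsCompact K → IntegrableOn (uncurry p) (Ioo 0 T ×ˢ K) volume)
    (hmom : ∀ ψ : ℝ → E → E, IsSpaceTimeTestOn (slab E (Ioo 0 T) isOpen_Ioo) ψ →
      ∫ z in Ioo 0 T ×ˢ (univ : Set E), (⟪u z.1 z.2, timeDeriv ψ z.1 z.2⟫ +
        ⟪u z.1 z.2, convect (u z.1) (ψ z.1) z.2⟫ + ν * ⟪u z.1 z.2, Δ (ψ z.1) z.2⟫ +
        p z.1 z.2 * VectorCalculus.divergence (ψ z.1) z.2 + ⟪f z.1 z.2, ψ z.1 z.2⟫) = 0)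
    (hf : ∀ K : Set E, IsCompact K → IntegrableOn (uncurry f) (Ioo 0 T ×ˢ K) volume)
    (hgood : ∀ᵐ t ∂((volume : Measure ℝ).restrict (Ioo 0 T)),
      AEStronglyMeasurable (u t) (volume : Measure E) ∧
        ∀ n : ℕ, ∫⁻ x in closedBall (0 : E) n, ‖u t x‖ₑ ^ 2 < ∞)
    (hm₀ : AEStronglyMeasurable u₀ (volume : Measure E))
    (h₀ : ∀ K : Set E, IsCompact K →
      Tendsto (fun t => ∫⁻ x in K, ‖u t x - u₀ x‖ₑ ^ 2) (𝓝[>] 0) (𝓝 0))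
    {φ : E → E} (hφ : FunctionSpaces.IsTestFunctionOn (⊤ : Opens E) φ) :
    ∀ᵐ t ∂((volume : Measure ℝ).restrict (Ioo 0 T)),
      ∫ x, ⟪u t x, φ x⟫ = (∫ x, ⟪u₀ x, φ x⟫) +
        ∫ s in Ioc 0 t, ∫ x, (⟪u s x, convect (u s) φ x⟫ + ν * ⟪u s x, Δ φ x⟫ +
          p s x * VectorCalculus.divergence φ x + ⟪f s x, φ x⟫) := by
  -- the compact shadow of `φ`
  set K : Set E := tsupport φ with hK_def
  have hK : IsCompact K := hφ.hasCompactSupport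
  have hφ0 : ∀ x, x ∉ K → φ x = 0 := fun x hx => image_eq_zero_of_notMem_tsupport hx
  have hφc : Continuous φ := hφ.contDiff.continuous
  have hφd : Differentiable ℝ φ := hφ.contDiff.differentiable (by simp)
  have hφ2 : ContDiff ℝ 2 φ := contDiff_infty.1 hφ.contDiff 2
  have cD : Continuous (fderiv ℝ φ) := hφ.contDiff.continuous_fderiv (by simp)
  have cL : Continuous (Δ φ) := continuous_laplacian hφ2
  have cdiv : Continuous (VectorCalculus.divergence φ) := by
    have : VectorCalculus.divergence φ = fun x => ∑ i, ⟪stdOrthonormalBasis ℝ E i,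
        fderiv ℝ φ x (stdOrthonormalBasis ℝ E i)⟫ := by
      funext x
      exact divergence_eq_sum_inner_fderiv (stdOrthonormalBasis ℝ E) φ x
    rw [this]
    exact continuous_finsetSum _ fun i _ => continuous_const.inner (cD.clm_apply continuous_const)
  have hD0 : ∀ x, x ∉ K → fderiv ℝ φ x = 0 := fun x hx => fderiv_of_notMem_tsupport ℝ hx
  have hL0 : ∀ x, x ∉ K → Δ φ x = 0 := fun x hx => laplacian_eq_zero_of_notMem_tsupport hx
  have hdiv0 : ∀ x, x ∉ K → VectorCalculus.divergence φ x = 0 := fun x hx => by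
    simp [VectorCalculus.divergence, hD0 x hx]
  -- integrability on the slab
  obtain ⟨hUK1, hUK2⟩ := hUK K hK
  have iB : Integrable (fun z : ℝ × E => ⟪u z.1 z.2, convect (u z.1) φ z.2⟫)
      (((volume : Measure ℝ).restrict (Ioo 0 T)).prod (volume : Measure E)) :=
    integrable_slab_inner_clm_apply (A := fun z : ℝ × E => fderiv ℝ φ z.2) hK hUK1 hUK2
      (cD.comp continuous_snd) fun t x hx => hD0 x hx
  have iC : Integrable (fun z : ℝ × E => ⟪u z.1 z.2, Δ φ z.2⟫)
      (((volume : Measure ℝ).restrict (Ioo 0 T)).prod (volume : Measure E)) :=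
    integrable_slab_inner (Ψ := fun z : ℝ × E => Δ φ z.2) hK hUK1 (cL.comp continuous_snd)
      fun t x hx => hL0 x hx
  have iP : Integrable (fun z : ℝ × E => p z.1 z.2 * VectorCalculus.divergence φ z.2)
      (((volume : Measure ℝ).restrict (Ioo 0 T)).prod (volume : Measure E)) :=
    integrable_slab_mul (g := fun z : ℝ × E => VectorCalculus.divergence φ z.2) hK (hpK K hK)
      (cdiv.comp continuous_snd) fun t x hx => hdiv0 x hx
  have iF : Integrable (fun z : ℝ × E => ⟪f z.1 z.2, φ z.2⟫)
      (((volume : Measure ℝ).restrict (Ioo 0 T)).prod (volume : Measure E)) :=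
    integrable_slab_inner (Ψ := fun z : ℝ × E => φ z.2) hK (hf K hK) (hφc.comp continuous_snd)
      fun t x hx => hφ0 x hx
  have iU : Integrable (fun z : ℝ × E => ⟪u z.1 z.2, φ z.2⟫)
      (((volume : Measure ℝ).restrict (Ioo 0 T)).prod (volume : Measure E)) :=
    integrable_slab_inner (Ψ := fun z : ℝ × E => φ z.2) hK hUK1 (hφc.comp continuous_snd)
      fun t x hx => hφ0 x hx
  set Φ₀ : ℝ × E → ℝ := fun z => ⟪u z.1 z.2, convect (u z.1) φ z.2⟫ + ν * ⟪u z.1 z.2, Δ φ z.2⟫ +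
    p z.1 z.2 * VectorCalculus.divergence φ z.2 + ⟪f z.1 z.2, φ z.2⟫ with hΦ₀
  have iΦ₀ : Integrable Φ₀ (((volume : Measure ℝ).restrict (Ioo 0 T)).prod (volume : Measure E)) :=
    ((iB.add (iC.const_mul ν)).add iP).add iF
  -- the functions of the du Bois-Reymond lemma
  set g : ℝ → ℝ := fun t => ∫ x, ⟪u t x, φ x⟫ with hg
  set F : ℝ → ℝ := fun t => ∫ x, Φ₀ (t, x) with hF
  set c : ℝ := ∫ x, ⟪u₀ x, φ x⟫ with hc
  have hgI : IntegrableOn g (Ioo 0 T) := iU.integral_prod_left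
  have hFI : IntegrableOn F (Ioo 0 T) := iΦ₀.integral_prod_left
  -- a.e. `x`-integrability of the slices
  have hsU : ∀ᵐ t ∂((volume : Measure ℝ).restrict (Ioo 0 T)),
      Integrable (fun x => ⟪u t x, φ x⟫) (volume : Measure E) := iU.prod_right_ae
  have hsΦ : ∀ᵐ t ∂((volume : Measure ℝ).restrict (Ioo 0 T)),
      Integrable (fun x => Φ₀ (t, x)) (volume : Measure E) := iΦ₀.prod_right_ae
  -- the identity of the du Bois-Reymond lemma
  have hident : ∀ η : ℝ → ℝ, ContDiff ℝ (⊤ : ℕ∞) η → HasCompactSupport η → tsupport η ⊆ Iio T →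
      (∫ s in Ioo 0 T, (deriv η s * g s + η s * F s)) + η 0 * c = 0 := by
    intro η hη hηc hηT
    have hψ : IsSpaceTimeTestOn (slab E (Iio T) isOpen_Iio) (fun s x => η s • φ x) :=
      isSpaceTimeTestOn_slab_smul isOpen_Iio hη hηc hηT hφ
    have key := weakIdentity_datum_pressure hT hUK hpK hmom hf hgood hm₀ h₀ hψ
    have hηd : Differentiable ℝ η := hη.differentiable (by simp)
    -- pointwise simplification of the integrand
    have hpt : ∀ t x, ⟪u t x, timeDeriv (fun s x => η s • φ x) t x⟫ +
        ⟪u t x, convect (u t) (fun x => η t • φ x) x⟫ + ν * ⟪u t x, Δ (fun x => η t • φ x) x⟫ +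
        p t x * VectorCalculus.divergence (fun x => η t • φ x) x + ⟪f t x, η t • φ x⟫ =
        deriv η t * ⟪u t x, φ x⟫ + η t * Φ₀ (t, x) := by
      intro t x
      have htd : timeDeriv (fun s x => η s • φ x) t x = deriv η t • φ x := by
        simp only [timeDeriv]
        exact deriv_smul_const (hηd t) (φ x)
      rw [htd, convect_fun_const_smul _ (hφd x), laplacian_fun_const_smul hφ2,
        divergence_fun_const_smul (hφd x), hΦ₀]
      simp only [real_inner_smul_right]
      ring
    have hinner : (∫ t in Ioo 0 T, ∫ x, (⟪u t x, timeDeriv (fun s x => η s • φ x) t x⟫ +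
        ⟪u t x, convect (u t) (fun x => η t • φ x) x⟫ + ν * ⟪u t x, Δ (fun x => η t • φ x) x⟫ +
        p t x * VectorCalculus.divergence (fun x => η t • φ x) x + ⟪f t x, η t • φ x⟫)) =
        ∫ t in Ioo 0 T, (deriv η t * g t + η t * F t) := by
      refine integral_congr_ae ?_
      filter_upwards [hsU, hsΦ] with t htU htΦ
      simp_rw [hpt]
      rw [integral_add (htU.const_mul _) (htΦ.const_mul _), integral_const_mul, integral_const_mul]
    have hdat : ∫ x, ⟪u₀ x, η 0 • φ x⟫ = η 0 * c := by
      simp only [real_inner_smul_right, hc]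
      exact integral_const_mul _ _
    rw [hinner, hdat] at key
    exact key
  have hmain := FunctionSpaces.ae_eq_add_setIntegral_of_forall_test hgI hFI hident
  filter_upwards [hmain] with t ht
  simpa only [hg, hF, hc, hΦ₀] using ht

/-- **`L^q` on a finite measure space is `L¹`** (`q ≥ 1`): an a.e.-strongly measurable `f`
with `∫⁻ ‖f‖ₑ^q < ∞` is integrable. [folklore] -/
theorem integrable_of_lintegral_rpow_enorm_lt_top {α F : Type*} [MeasurableSpace α]
    {μ : Measure α} [IsFiniteMeasure μ] [NormedAddCommGroup F] {g : α → F}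
    (hg : AEStronglyMeasurable g μ) {q : ℝ} (hq : 1 ≤ q) (h : ∫⁻ a, ‖g a‖ₑ ^ q ∂μ < ∞) :
    Integrable g μ := by
  have hq0 : (0 : ℝ) < q := by linarith
  have hmem : MemLp g (ENNReal.ofReal q) μ := by
    refine ⟨hg, ?_⟩
    rw [eLpNorm_lt_top_iff_lintegral_rpow_enorm_lt_top (by simpa using hq0) ENNReal.ofReal_ne_top,
      ENNReal.toReal_ofReal hq0.le]
    exact h
  exact hmem.integrable (ENNReal.one_le_ofReal.2 hq)

/-- The pressure of a local Leray solution is integrable on the finite cylinders `(0,T) × K`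
(`π ∈ L^{3/2}((0,T) × K)`, `K` compact, and `L^{3/2} ⊂ L¹` there). [folklore] -/
theorem _root_.Literature.Analysis.FluidPDE.IsLocalLeraySolution.integrableOn_pressure_cylinder
    {ν : ℝ} {v₀ : (EuclideanSpace ℝ (Fin 3)) → (EuclideanSpace ℝ (Fin 3))} {v : ℝ → (EuclideanSpace ℝ (Fin 3)) → (EuclideanSpace ℝ (Fin 3))} {π : ℝ → (EuclideanSpace ℝ (Fin 3)) → ℝ} (h : IsLocalLeraySolution ν v₀ v π)
    {T : ℝ} (hT : 0 < T) {K : Set (EuclideanSpace ℝ (Fin 3))} (hK : IsCompact K) :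
    IntegrableOn (uncurry π) (Ioo 0 T ×ˢ K) volume := by
  haveI : IsFiniteMeasure ((volume : Measure (ℝ × (EuclideanSpace ℝ (Fin 3)))).restrict (Ioo 0 T ×ˢ K)) :=
    ⟨by rw [Measure.restrict_apply_univ]; exact volume_Ioo_prod_lt_top hK⟩
  have hsub : Ioo 0 T ×ˢ K ⊆ ((slab (EuclideanSpace ℝ (Fin 3)) (Ioi 0) isOpen_Ioi : Opens (ℝ × (EuclideanSpace ℝ (Fin 3)))) : Set (ℝ × (EuclideanSpace ℝ (Fin 3)))) :=
    fun z hz => mem_slab.2 (Ioo_subset_Ioi_self hz.1)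
  have hm : AEStronglyMeasurable (uncurry π) ((volume : Measure (ℝ × (EuclideanSpace ℝ (Fin 3)))).restrict (Ioo 0 T ×ˢ K)) :=
    (h.suitable.distributional.2.2.1.mono_set hsub).aestronglyMeasurable
  exact integrable_of_lintegral_rpow_enorm_lt_top hm (by norm_num : (1 : ℝ) ≤ 3 / 2)
    (h.pressure T hT K hK)

/-- **Weak continuity at `t = 0` of a local Leray solution, sliced form** (Jia–Šverák 2014 /
Kang–Miura–Tsai Def. 3.2 solutions; the identity `⟨v(t), φ⟩ = ⟨v₀, φ⟩ + ∫₀ᵗ ⟨v ⊗ v : ∇φ + v·Δφ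
+ π div φ⟩` for a.e. `t`, Lemarié-Rieusset 2016, Prop. 14.1, first step; here from
`ae_pairing_eq_datum_add_setIntegral`). For every test field `φ` and a.e. `t ∈ (0,T)`,
`∫ ⟪v(t), φ⟫ = ∫ ⟪v₀, φ⟫ + ∫_{(0,t]} ∫ (⟪v, (v·∇)φ⟫ + ⟪v, Δφ⟫ + π div φ)`. [cite: LemarieRieusset2016, Prop. 14.1] -/
theorem _root_.Literature.Analysis.FluidPDE.IsLocalLeraySolution.ae_pairing_eq_datum_add
    {v₀ : (EuclideanSpace ℝ (Fin 3)) → (EuclideanSpace ℝ (Fin 3))} {v : ℝ → (EuclideanSpace ℝ (Fin 3)) → (EuclideanSpace ℝ (Fin 3))} {π : ℝ → (EuclideanSpace ℝ (Fin 3)) → ℝ} (h : IsLocalLeraySolution 1 v₀ v π)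
    (hm₀ : AEStronglyMeasurable v₀ volume) {T : ℝ} (hT : 0 < T) {φ : (EuclideanSpace ℝ (Fin 3)) → (EuclideanSpace ℝ (Fin 3))}
    (hφ : FunctionSpaces.IsTestFunctionOn (⊤ : Opens (EuclideanSpace ℝ (Fin 3))) φ) :
    ∀ᵐ t ∂((volume : Measure ℝ).restrict (Ioo 0 T)),
      ∫ x, ⟪v t x, φ x⟫ = (∫ x, ⟪v₀ x, φ x⟫) +
        ∫ s in Ioc 0 t, ∫ x, (⟪v s x, convect (v s) φ x⟫ + ⟪v s x, Δ φ x⟫ +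
          π s x * VectorCalculus.divergence φ x) := by
  have hmeas : AEStronglyMeasurable (uncurry v)
      ((volume : Measure (ℝ × (EuclideanSpace ℝ (Fin 3)))).restrict (Ioo 0 T ×ˢ univ)) :=
    h.aestronglyMeasurable.mono_measure
      (Measure.restrict_mono (Set.prod_mono Ioo_subset_Ioi_self Subset.rfl) le_rfl)
  have hsq : ∀ K : Set (EuclideanSpace ℝ (Fin 3)), IsCompact K → ∫⁻ z in Ioo 0 T ×ˢ K, ‖uncurry v z‖ₑ ^ 2 < ∞ :=
    fun K hK => h.sqIntegrable T hT K hK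
  have hUK : ∀ K : Set (EuclideanSpace ℝ (Fin 3)), IsCompact K → IntegrableOn (uncurry v) (Ioo 0 T ×ˢ K) volume ∧
      IntegrableOn (fun z => ‖uncurry v z‖ ^ 2) (Ioo 0 T ×ˢ K) volume := fun K hK =>
    integrableOn_cylinder_of_lintegral_sq_slab hmeas hsq hK
  have hpK : ∀ K : Set (EuclideanSpace ℝ (Fin 3)), IsCompact K → IntegrableOn (uncurry π) (Ioo 0 T ×ˢ K) volume :=
    fun K hK => h.integrableOn_pressure_cylinder hT hK
  have hle : (slab (EuclideanSpace ℝ (Fin 3)) (Ioo 0 T) isOpen_Ioo : Opens (ℝ × (EuclideanSpace ℝ (Fin 3)))) ≤ slab (EuclideanSpace ℝ (Fin 3)) (Ioi 0) isOpen_Ioi :=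
    slab_mono Ioo_subset_Ioi_self
  have hdist := h.distributional.of_le hle
  have hmom : ∀ ψ : ℝ → (EuclideanSpace ℝ (Fin 3)) → (EuclideanSpace ℝ (Fin 3)), IsSpaceTimeTestOn (slab (EuclideanSpace ℝ (Fin 3)) (Ioo 0 T) isOpen_Ioo) ψ →
      ∫ z in Ioo 0 T ×ˢ (univ : Set (EuclideanSpace ℝ (Fin 3))), (⟪v z.1 z.2, timeDeriv ψ z.1 z.2⟫ +
        ⟪v z.1 z.2, convect (v z.1) (ψ z.1) z.2⟫ + 1 * ⟪v z.1 z.2, Δ (ψ z.1) z.2⟫ +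
        π z.1 z.2 * VectorCalculus.divergence (ψ z.1) z.2 +
        ⟪(0 : ℝ → (EuclideanSpace ℝ (Fin 3)) → (EuclideanSpace ℝ (Fin 3))) z.1 z.2, ψ z.1 z.2⟫) = 0 := fun ψ hψ => hdist.2.2.2.2 ψ hψ
  have hf : ∀ K : Set (EuclideanSpace ℝ (Fin 3)), IsCompact K →
      IntegrableOn (uncurry (0 : ℝ → (EuclideanSpace ℝ (Fin 3)) → (EuclideanSpace ℝ (Fin 3)))) (Ioo 0 T ×ˢ K) volume := fun K hK =>
    integrableOn_zero
  have hgood := ae_slice_aestronglyMeasurable_and_lintegral_ball_lt_top hmeas hsq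
  have key := ae_pairing_eq_datum_add_setIntegral hT hUK hpK hmom hf hgood hm₀
    (fun K hK => h.initial K hK) hφ
  filter_upwards [key] with t ht
  simpa only [one_mul, Pi.zero_apply, inner_zero_left, add_zero] using ht

end BradshawTsai2019



end Literature.Analysis.FluidPDE

end
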